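import Literature.AlgebraicGeometry.Frobenioids.ProfiniteUnitsComponents
import HarnessLib

/-!
# Frobenioids I, Proposition 5.6, group-theoretic core: solving `u^{l-1} = w_l` in a profinite abelian group — proofs

Mochizuki, *The geometry of Frobenioids I*, Kyushu J. Math. **62** (2008), §5, proof of
Proposition 5.6, kurims p. 107 [cite: MochizukiFrdI2008, Prop. 5.6 p.107].  The existence of the
conjugating unit `u ∈ O^×(A)` is reduced there to pro-`p` portions: "since, for `w ∈ O^×(A)[p]`, we
have … `w · φ_l · w⁻¹ ≈ w^{1-l} · φ_l` … and `O^×(A)[p]` is a pro-`p` group, it follows that there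
exists a `u_p ∈ O^×(A)[p]` such that `u_p · φ_p · u_p⁻¹ ≈ φ'_p`", the `u_p` are assembled into `u`, and
the remaining primes are handled by the commutation `φ_{l₁} φ_{l₂} = φ_{l₂} φ_{l₁}`.  Abstractly:

* `IsTfgProfinite.pow_injOn_proL`, `IsTfgProfinite.exists_pow_eq_of_mem_proL` — for `k` prime to
  `p`, `y ↦ y^k` is a bijection of the pro-`p` portion `M[p]` ("`O^×(A)[p]` is a pro-`p` group");
* `IsTfgProfinite.exists_pow_pred_eq` — **the cocycle lemma**: if `w_{l₁}^{l₂-1} = w_{l₂}^{l₁-1}` for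
  all primes `l₁, l₂`, then `u^{l-1} = w_l` for all primes `l`, for a suitable `u`.

Part of the dossier for [FrdI] Prop. 5.6 (pool item D-θ of the abc-iut cell).  No new definitions.
-/

namespace Literature.AlgebraicGeometry.Frobenioids

open _root_.Topology Filter

universe u

namespace IsTfgProfinite

variable {M : Type u} [CommGroup M] [TopologicalSpace M]

/-- For `k` prime to `p`, `y ↦ y^k` is injective on the pro-`p` portion `M[p]`.
[cite: MochizukiFrdI2008, Prop. 5.6 p.107] -/
theorem pow_injOn_proL (h : IsTfgProfinite M) {p : Nat.Primes} {k : ℕ} (hk : Nat.Coprime k p) :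
    Set.InjOn (fun y : M => y ^ k) (proL M p) := by
  intro y₁ hy₁ y₂ hy₂ hpow
  have hz : y₁ / y₂ ∈ proL M p := (proL M p).div_mem hy₁ hy₂
  have hz1 : (y₁ / y₂) ^ k = 1 := by
    rw [div_pow, show y₁ ^ k = y₂ ^ k from hpow, div_self']
  refine div_eq_one.mp (h.eq_one_of_forall_mem fun U => ?_)
  have h1 := h.pow_ordProj_index_mem hz U
  have h2 : (y₁ / y₂) ^ k ∈ U := by rw [hz1]; exact U.one_mem
  have hcop : Nat.Coprime k (ordProj[(p : ℕ)] (U : Subgroup M).index) := hk.pow_right _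
  have := pow_gcd_mem U h2 h1
  rwa [hcop.gcd_eq_one, pow_one] at this

/-- For `k` prime to `p`, every element of `M[p]` is a `k`-th power of an element of `M[p]` (the
`ζ`-th power map with `ζ(p) = k`, `ζ(l) = 1` otherwise is bijective, Def. 2.8 (iii), and preserves the
components). [cite: MochizukiFrdI2008, Prop. 5.6 p.107] -/
theorem exists_pow_eq_of_mem_proL (h : IsTfgProfinite M) {p : Nat.Primes} {k : ℕ+}
    (hk : Nat.Coprime k p) {y : M} (hy : y ∈ proL M p) :
    ∃ x ∈ proL M p, x ^ (k : ℕ) = y := by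
  classical
  let ζ : Nat.Primes → ℕ+ := fun l => if l = p then k else 1
  have hζ : IsOfCoprimeType ζ := by
    intro l
    by_cases hl : l = p
    · subst hl; simpa [ζ] using hk
    · simp [ζ, hl]
  obtain ⟨f, hf, -⟩ := ZetaPowerMapExistsUnique_holds M ζ h
  have hbij := ZetaPowerMapBijectiveOfCoprime_holds M ζ h hζ f hf
  obtain ⟨x, hx⟩ := hbij.2 y
  obtain ⟨π, hπmem, hπ, hπid, hπzero⟩ := h.exists_proLProjections
  -- the components of `x` away from `p` vanish
  have hxl : ∀ l, l ≠ p → π l x = 1 := by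
    intro l hl
    have hnat := h.map_zetaPowerMap h hf hf (π l) x
    rw [hx, hπzero l p (Ne.symm hl) y hy, hf.eq_pow l (π l x) (hπmem l x)] at hnat
    simp only [ζ, if_neg hl, PNat.one_coe, pow_one] at hnat
    exact hnat.symm
  have hxp : x = π p x := by
    refine h.eq_of_proj_eq hπ fun l => ?_
    by_cases hl : l = p
    · subst hl; exact (hπid l _ (hπmem l x)).symm
    · rw [hxl l hl, hπzero l p (Ne.symm hl) _ (hπmem p x)]
  have hxmem : x ∈ proL M p := hxp ▸ hπmem p x
  refine ⟨x, hxmem, ?_⟩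
  have := hf.eq_pow p x hxmem
  simp only [ζ, if_pos rfl] at this
  rw [← this, hx]

/-- **The cocycle lemma** (core of [FrdI] Prop. 5.6, p. 107).  In a topologically finitely generated
profinite abelian group, a family `(w_l)_{l prime}` with `w_{l₁}^{l₂-1} = w_{l₂}^{l₁-1}` for all
`l₁, l₂` is of the form `w_l = u^{l-1}` for a single `u`: on the pro-`p` portion `x ↦ x^{p-1}` is
bijective, which produces `u_p` with `u_p^{p-1} = (w_p)_p` and forces `u_p^{l-1} = (w_l)_p` for the
other primes; `u := ∏'_p u_p`. [cite: MochizukiFrdI2008, Prop. 5.6 p.107] -/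
theorem exists_pow_pred_eq (h : IsTfgProfinite M) (w : Nat.Primes → M)
    (hw : ∀ l₁ l₂ : Nat.Primes, w l₁ ^ ((l₂ : ℕ) - 1) = w l₂ ^ ((l₁ : ℕ) - 1)) :
    ∃ u : M, ∀ l : Nat.Primes, u ^ ((l : ℕ) - 1) = w l := by
  classical
  obtain ⟨π, hπmem, hπ, hπid, hπzero⟩ := h.exists_proLProjections
  -- `p - 1` as a positive integer prime to `p`
  have hk : ∀ p : Nat.Primes, ∃ k : ℕ+, (k : ℕ) = (p : ℕ) - 1 ∧ Nat.Coprime k p := fun p =>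
    ⟨⟨(p : ℕ) - 1, Nat.sub_pos_of_lt p.2.one_lt⟩, rfl,
      (Nat.coprime_self_sub_left p.2.one_lt.le).mpr (Nat.coprime_one_left _)⟩
  choose k hk hkcop using hk
  -- the components `u_p`
  have hup : ∀ p, ∃ x ∈ proL M p, x ^ ((p : ℕ) - 1) = π p (w p) := fun p => by
    obtain ⟨x, hx, hxk⟩ := h.exists_pow_eq_of_mem_proL (hkcop p) (hπmem p (w p))
    exact ⟨x, hx, by rw [← hk p]; exact hxk⟩
  choose up hupmem hupeq using hup
  obtain ⟨u, hu⟩ := h.exists_hasProd_of_mem_proL up hupmem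
  have hπu : ∀ p, π p u = up p := fun p => h.proj_eq_of_hasProd hπid hπzero hupmem hu p
  refine ⟨u, fun l => h.eq_of_proj_eq hπ fun p => ?_⟩
  rw [map_pow, hπu]
  by_cases hpl : p = l
  · subst hpl
    exact hupeq p
  -- `p ≠ l`: compare `(p-1)`-th powers inside `M[p]`
  have hcop : Nat.Coprime ((p : ℕ) - 1) p := hk p ▸ hkcop p
  refine h.pow_injOn_proL hcop ((proL M p).pow_mem (hupmem p) _) (hπmem p (w l)) ?_
  show (up p ^ ((l : ℕ) - 1)) ^ ((p : ℕ) - 1) = (π p (w l)) ^ ((p : ℕ) - 1)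
  rw [pow_right_comm, hupeq p, ← map_pow, ← map_pow, hw l p]

end IsTfgProfinite

end Literature.AlgebraicGeometry.Frobenioids
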